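import Mathlib.LinearAlgebra.Matrix.PosDef
import Mathlib.LinearAlgebra.Matrix.Trace
import Mathlib.LinearAlgebra.Matrix.Hermitian
import Mathlib.Data.Matrix.Composition
import Mathlib.Analysis.Complex.Order
import Mathlib.Analysis.Complex.Basic
import HarnessLib

/-!
# Verbitsky's pointwise inequality `Tr Λ_c²(Θ^{2,0} ∧ Θ^{2,0}) < 0` (the Bogomolov–Gieseker-type
# inequality (5.1) behind "stable with `G_M`-invariant `c₁, c₂` ⇒ hyperholomorphic", Verbitsky 1996 Thm. 2.5),
# in his coordinates, at the level of the coefficient matrices `A_ij`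

Topic `Literature/Geometry/Hyperkaehler`, namespace `Literature.Geometry.Hyperkaehler.TwoZeroCurvature`. Written by the
literature seat `lit-w-verbitsky` (gen 11) of the cell `pub-hsemireg` (HodgeConjecture venture), 2026-08-24, as the
kernel leg of the MECHANISM of row V-V1 (the bundle criterion, Verbitsky 1996 Thm. 2.5) of that cell's Verbitsky table
— the one step of the printed proof of Thm. 2.5 that is finite-dimensional linear algebra. THEOREMS ONLY (no
definition, no named fact, no `sorry`).

## Source, verbatim (M. Verbitsky, *Hyperholomorphic bundles over a hyperkähler manifold*, arXiv:alg-geom/9307008v1,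
29 Jul 1993 = J. Alg. Geom. 5 (1996) 633–669; §5 "Proof of Theorem 2.5, which states that the stable bundle is
hyperholomorphic if its first two Chern classes are invariant with respect to the isotropy group of the base
hyperkähler manifold", arXiv PDF pp. 18–21; page/line = the text layer of that PDF; pp. 20–21 print the bidegree of
the component as a SUBSCRIPT, "`Θ_{2,0}`", "`Θ_{0,2}`" — we write `Θ^{2,0}` uniformly, as on pp. 18–19)

* p.18 L20–33: "Let `B` be a holomorphic stable bundle over `(M, J)`. Take the a Yang–Mills connection in `B`. Assume
  that `c₁(B)` and `c₂(B)` are `G_M`-invariant. Let `Θ` be a curvature of `B`; we need to prove that `Θ` is of type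
  `(1,1)` with respect to all induced complex structures on `M`, or, what is the same, that `Θ` is `G_M`-invariant. Let
  `I` be an induced complex structure over `M`, such that `I∘J = −J∘I` and `I∘J` is another induced complex structure.
  […] Therefore it is sufficient to prove that `Θ` is of type `(1,1)` with respect to `I`. Let
  `Θ = Θ^{2,0} + Θ^{1,1} + Θ^{0,2}` be a Hodge decomposition of `Θ` with respect to `I`. Let `Λ_c = Λ_J + √−1 Λ_K`, as
  in Section 4. This is an operator of Hodge type `(−2,0)`. For each point `x ∈ M` one can define a constant
  `Tr(Λ_c²(Θ^{2,0} ∧ Θ^{2,0}))`."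
* p.19 L1–7, **inequality (5.1)**: "In the end of this section, we will prove the analogue of Bogomolov–Gieseker
  ([Ko], [S]) unequality (5.1) `Tr(Λ_c²(Θ^{2,0} ∧ Θ^{2,0})) < 0` for point `x ∈ M` such that `Θ^{2,0} ≠ 0` as a
  section of `Λ^{2,0}(End(B))` at this point."
* p.19 L50–58 (how (5.1) is used): "This statement together with formula (5.1) imply that `Λ_c²(c₂(B)) ≤ 0` and
  `Λ_c²(c₂(B)) = 0` only if `Θ^{2,0} = 0` everywhere. Therefore, if `Λ_c²(c₂(B)) = 0`, the form `Θ^{2,0} = 0`. Since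
  `B` is a Hermitian bundle, `Θ^{0,2} = Θ̄^{2,0}`. This implies that for any induced complex structure `I`, the operator,
  `ad I` acts trivially on `Θ (= Θ^{1,1})`. This implies that `Θ` is `G_M`-invariant, and the bundle `B` is
  hyperholomorphic. Theorem 2.5 is proven (modulo the unequality (5.1))."
* p.20 L5–27 (the coordinates): "Let `x₁, x'₁, x₂, x'₂ … x_n, x'_n` be coordinates in the bundle `Λ^{1,0}_I(M)` for
  some open set `U ⊂ M` such that `J̄(x_i) = x'_i` and `ω_J + √−1 ω_K = Σ_{i=1…n} x_i ∧ x'_i` […] Let us represent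
  `Θ^{2,0} = Σ_{i,j=1…n} A_ij x_i ∧ x'_j` where `A_ij` is a section of `End(B)` over `U`."
* p.20 L28–35, **(5.4)**: "Since `J̄(Θ^{2,0}) = Θ^{2,0}`, and the real structure in `End(B)` is defined by `A ⟶ −A^⊥`,
  we have `Σ A_ij x_i ∧ x'_j = Σ −A^⊥_ij x'_i ∧ x_j`. Therefore, (5.4) `A_ij = A^⊥_ij`."
* p.20 L36–58, **(5.5)**: "On the other hand, for any form `Σ B_ij x_i ∧ x'_j`, `Λ_c(Σ B_ij x_i ∧ x'_j) = Σ_{i=1…n} B_ii`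
  because the canonical holomorphic symplectic form is equal to `Σ_{i=1…n} x_i ∧ x'_i`. We have proved earlier that
  `Λ_c(Σ A_ij x_i ∧ x'_j)` is a zero section of `End(B)`. Therefore (5.5) `Σ A_ii = 0` at each point of `M`."
* p.20 L59–67: "An easy calculation shows that `Λ_c²(Θ^{2,0} ∧ Θ^{2,0}) = Σ_{i≠j} −A_ij A_ji + Σ_{i≠j} A_ii A_jj`."
* p.20 L68–p.21 L1: "Since `Tr(AA^⊥) > 0` for every non-zero matrix `A`, we have that
  `Tr Σ_{i≠j} −A_ij A_ji =(5.4)= Tr Σ_{i≠j} −A_ij A^⊥_ij < 0` if any of `A_ij`, `i ≠ j` is non-zero."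
* p.21 L2–33: "On the other hand, let us show that `Tr Σ_{i≠j} A_ii A_jj < 0`, if not all matrices `A_ii`, `i = 1…n`
  are zero. First of all, `2 Σ_{i≠j} A_ii A_jj = (Σ A_ii)² − Σ A_ii²`. By (5.5), `Σ A_ii = 0` and therefore
  `2 Σ_{i≠j} A_ii A_jj = −Σ A_ii²`. By the previous argument, `Tr Σ_{i=1…n} −A_ii² =(5.4)= Tr Σ_{i≠j} −A_ii A_ii^⊥ ≤ 0`"
* p.21 L34–41: "Therefore `Tr(Λ_C²(Θ^{2,0} ∧ Θ^{2,0})) = Tr Σ_{i≠j} −A_ii A_ii^⊥ + Tr Σ_{i≠j} −A_ij A^⊥_ij < 0` if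
  `Θ^{2,0} ≠ 0`. This proves unequality (5.1)."

## Dictionary

At one point `x ∈ M`: `ι` = the index set `{1, …, n}` of the coordinates `x_i, x'_i` (`dim_ℂ M = 2n`), `m` = an index
set of a frame of the fibre `B_x` (`End(B_x) = M_r(ℂ) = Matrix m m ℂ`), `A^⊥` = the Hermitian adjoint = `Aᴴ`. The
coefficient family `(A_ij)` of `Θ^{2,0} = Σ_{i,j} A_ij x_i ∧ x'_j` is ONE block matrix
`A : Matrix ι ι (Matrix m m ℂ)` (so `Σ_i A_ii = Matrix.trace A ∈ M_r(ℂ)` is its partial trace over `ι`, and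
`Matrix.comp` identifies `A` with an `(ι × m) × (ι × m)` complex matrix `Â`). "`Σ_{i≠j}`" = the sum over ORDERED pairs
`(i, j)`, `j ≠ i` (`∑ i, ∑ j ∈ univ.erase i`). Hypotheses AS USED in the printed proof: (5.4)
`h54 : ∀ i j, A j i = (A i j)ᴴ` (precision P-V51-1 below) and (5.5) `h55 : ∑ i, A i i = 0`. Verbitsky's pointwise
quantity is the expression he computes for it, `Σ_{i≠j} (A_ii A_jj − A_ij A_ji) ∈ M_r(ℂ)` and its trace
`Tr Σ_{i≠j} (A_ii A_jj − A_ij A_ji) ∈ ℂ`; "`< 0`" for a complex number is read in the order of `ℂ`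
(`open scoped ComplexOrder`: real and negative), and also spelled out on real and imaginary parts.

## What is formalised (theorems only)

* §1 (any ring `S` of coefficients, `A : Matrix ι ι S`): the diagonal summands of Verbitsky's expression cancel
  (`sum_erase_eq_sum_sum`), so **`sum_erase_eq_trace_sq_sub_trace_mul_self`**:
  `Σ_{i≠j} (A_ii A_jj − A_ij A_ji) = (Tr_ι A)² − Tr_ι(A²)`; the printed steps `Σ_{i≠j} A_ii A_jj = (Σ A_ii)² − Σ A_ii²`
  (`sum_erase_diag_mul_diag`, ordered pairs — precision P-V51-2), "`= −Σ A_ii²` by (5.5)"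
  (`sum_erase_diag_mul_diag_of_sum_diag_eq_zero`), the off-diagonal sum `Σ_{i≠j} A_ij A_ji = Tr_ι(A²) − Σ A_ii²`
  (`sum_erase_mul_swap`), and under (5.5) `Σ_{i≠j} (A_ii A_jj − A_ij A_ji) = −Tr_ι(A²)`
  (`sum_erase_eq_neg_trace_mul_self_of_sum_diag_eq_zero`).
* §2 (`M_r(ℂ)`): "`Tr(AA^⊥) > 0` for every non-zero matrix `A`" — `trace_mul_conjTranspose_eq_sum_normSq`
  (`Tr(A A^⊥) = Σ_{k,l} |A_kl|²`), **`trace_mul_conjTranspose_pos`**.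
* §3 **inequality (5.1)** for `A : Matrix ι ι (Matrix m m ℂ)` under (5.4)–(5.5): the two printed halves —
  `trace_sum_erase_neg_mul_swap_eq` / **`trace_sum_erase_neg_mul_swap_neg`** (off-diagonal part
  `Tr Σ_{i≠j} −A_ij A_ji = −Σ_{i≠j} Σ_{k,l} |(A_ij)_kl|² < 0` "if any of `A_ij`, `i ≠ j` is non-zero"; needs (5.4) only)
  and `trace_sum_erase_diag_mul_diag_eq` / **`trace_sum_erase_diag_mul_diag_neg`** (diagonal part
  `Tr Σ_{i≠j} A_ii A_jj = −Σ_i Σ_{k,l} |(A_ii)_kl|² < 0` "if not all matrices `A_ii` are zero"; needs `A_ii = A_ii^⊥` and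
  (5.5)); the printed last line as a decomposition (`trace_sum_erase_eq_diag_add_offDiag`); and the closed form
  **`trace_sum_erase_eq_neg_sum_normSq`**: `Tr Σ_{i≠j} (A_ii A_jj − A_ij A_ji) = −Σ_{i,j} Σ_{k,l} |(A_ij)_kl|²`, whence
  **`trace_sum_erase_nonpos`** (`≤ 0`), **`trace_sum_erase_eq_zero_iff`** (`= 0 ↔ A = 0`, the "only if `Θ^{2,0} = 0`"
  of p.19 L53), **`trace_sum_erase_neg`** ((5.1) as printed: `< 0` whenever `A ≠ 0`), and the real/imaginary-part
  readings `re_trace_sum_erase_eq`, `re_trace_sum_erase_neg`.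
* §4 the same on the block matrix `Â = Matrix.comp ι ι m m ℂ A`: (5.4) iff `Â` is Hermitian (`isHermitian_comp_iff`);
  with no hypothesis `Tr Σ_{i≠j} (A_ii A_jj − A_ij A_ji) = Tr_m((Tr_ι A)²) − Tr(Â²)`
  (`trace_sum_erase_eq_trace_sq_sub_trace_comp_sq`); under (5.4)–(5.5) it is `−Tr(Â Â^⊥)`
  (`trace_sum_erase_eq_neg_trace_comp_mul_conjTranspose`) and vanishes iff `Â = 0`
  (`trace_sum_erase_eq_zero_iff_comp_eq_zero`, via Mathlib's `Matrix.trace_mul_conjTranspose_self_eq_zero_iff`).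
* §5 the opposite sign convention (precision P-V51-3): under `A_ji = −A_ij^⊥` and (5.5) the same trace is
  `+Σ |(A_ij)_kl|² ≥ 0`, again `= 0` iff `A = 0` (`trace_sum_erase_eq_sum_normSq_of_skew`,
  `trace_sum_erase_eq_zero_iff_of_skew`).

## Reading precisions (records, not errata claims)

* P-V51-1. (5.4) is printed "`A_ij = A^⊥_ij`"; both places where it is invoked (p.20 L69–78
  "`Tr Σ_{i≠j} −A_ij A_ji =(5.4)= Tr Σ_{i≠j} −A_ij A^⊥_ij`", p.21 L22–33 "`Tr Σ −A_ii² =(5.4)= Tr Σ −A_ii A_ii^⊥`") use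
  `A_ji = (A_ij)^⊥` for all `i, j` — the block matrix `(A_ij)` is Hermitian, in particular every `A_ii` is — which is
  also what the displayed line "`Σ A_ij x_i ∧ x'_j = Σ −A^⊥_ij x'_i ∧ x_j`" gives on comparing the coefficients of
  `x_j ∧ x'_i`. This file takes (5.4) in that form (`h54`).
* P-V51-2. "`2 Σ_{i≠j} A_ii A_jj = (Σ A_ii)² − Σ A_ii²`": over ordered pairs `i ≠ j` (the reading under which the
  off-diagonal half is summed) the identity holds WITHOUT the factor `2` (§1); the factor only rescales a non-positive
  term and does not affect (5.1). In p.21 L31 and L38 "`Σ_{i≠j} −A_ii A_ii^⊥`" the index set is `i = 1…n`.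
* P-V51-3. The overall signs of "`Λ_c²(Θ^{2,0} ∧ Θ^{2,0}) = Σ_{i≠j} −A_ij A_ji + Σ_{i≠j} A_ii A_jj`" ("an easy
  calculation", taken as printed, NOT re-derived here) and of (5.4) depend on normalisations the text leaves implicit
  (the sign of `Λ_c` as an adjoint, `J̄(x'_i) = −x_i` from `J̄² = −1`, and the choice between the real structures
  `A ↦ −A^⊥` and `A ↦ A^⊥` — §3, p.11 L22–23: "For a real structure `T`, the operator `−T` also defines a real
  structure"). What the proof of Thm. 2.5 uses (p.19 L50–55) is only that the trace is a DEFINITE form in the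
  coefficients `(A_ij)` vanishing exactly at `Θ^{2,0} = 0`; §5 records that this survives the sign flip.

## Scope (faithfulness)

(i) Pointwise and in coordinates only: the objects are the coefficient matrices `A_ij` of `Θ^{2,0}` at one point in
Verbitsky's frame `x_i, x'_i`; hypotheses (5.4) and (5.5) are ASSUMED in the form the proof uses them — their
derivations (reality of `Θ` and `J̄ Θ^{2,0} = Θ^{2,0}` for (5.4); Yang–Mills `Λ_J Θ = 0`, type and reality for
`Λ_I Θ = Λ_K Θ = 0`, hence `Λ_c Θ^{2,0} = 0`, for (5.5): p.20 L1–4, L51–58) involve the connection and are not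
formalised. (ii) The identification of `Σ_{i≠j} (−A_ij A_ji + A_ii A_jj)` with `Λ_c²(Θ^{2,0} ∧ Θ^{2,0})` ("an easy
calculation") is taken from print; this file proves the inequality for the printed expression. (iii) Nothing global:
(5.1A) (Chern–Weil), (5.2)–(5.3) (integration, Hodge types of `Λ_c`) and the conclusion of Thm. 2.5 are not here;
nor are Thm. 2.5 itself, stability, or Yang–Mills connections (cf. `Hyperholomorphic.lean`, "What is NOT here").
(iv) The entries live in `ℂ` as in the source; `ι`, `m` are arbitrary finite types.

## References

* [Verbitsky1996Hyperholomorphic] M. Verbitsky, *Hyperholomorphic bundles over a hyperkähler manifold*, J. Alg. Geom.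
  5 (1996) 633–669 = arXiv:alg-geom/9307008 (arXiv numbering; JAG pages unseen), §5, pp. 18–21 of the arXiv v1 PDF:
  (5.1), (5.4), (5.5) and the proof of (5.1) (read); §3 p. 11 L22–23 (real structures `±T`); Thm. 2.5 p. 9 L5–8.
* [Kobayashi1987] S. Kobayashi, *Differential Geometry of Complex Vector Bundles* (1987), IV §4 (the Lübke /
  Bogomolov–Gieseker inequality for Einstein–Hermitian bundles) — Verbitsky's "[Ko]"; not used here.
-/

open Matrix Finset
open scoped ComplexOrder

namespace Literature.Geometry.Hyperkaehler.TwoZeroCurvature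

variable {ι : Type*} [Fintype ι]

/-! ### §1 Verbitsky's expression `Σ_{i≠j} (A_ii A_jj − A_ij A_ji)` over any ring of coefficients -/

section Ring

variable {S : Type*} [Ring S]

/-- The partial trace `Σ_i A_ii` of a block family is the trace of the block matrix over the block index. [folklore] -/
private theorem trace_eq_sum_diag (A : Matrix ι ι S) : trace A = ∑ i, A i i := rfl

/-- `Σ_{i,j} A_ij A_ji = Tr_ι(A²)`. [folklore] -/
private theorem sum_sum_mul_swap_eq_trace_mul_self (A : Matrix ι ι S) :
    ∑ i, ∑ j, A i j * A j i = trace (A * A) := by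
  simp only [trace, diag_apply, mul_apply]

/-- `Σ_{i,j} A_ii A_jj = (Σ_i A_ii)²`. [folklore] -/
private theorem sum_sum_diag_mul_diag_eq_sq (A : Matrix ι ι S) :
    ∑ i, ∑ j, A i i * A j j = (∑ i, A i i) ^ 2 := by
  rw [sq, Finset.sum_mul_sum]

variable [DecidableEq ι]

/-- The diagonal summands of Verbitsky's expression cancel: the sum over ORDERED pairs `i ≠ j` of
`A_ii A_jj − A_ij A_ji` equals the unrestricted double sum (the `i = j` summand is `A_ii A_ii − A_ii A_ii = 0`).
[cite: Verbitsky1996Hyperholomorphic, §5 p.20 L59–67 ("Λ_c²(Θ^{2,0} ∧ Θ^{2,0}) = Σ_{i≠j} −A_ij A_ji + Σ_{i≠j} A_ii A_jj")] -/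
theorem sum_erase_eq_sum_sum (A : Matrix ι ι S) :
    ∑ i, ∑ j ∈ univ.erase i, (A i i * A j j - A i j * A j i) =
      ∑ i, ∑ j, (A i i * A j j - A i j * A j i) := by
  refine Finset.sum_congr rfl fun i _ => ?_
  rw [Finset.sum_erase_eq_sub (Finset.mem_univ i), sub_self, sub_zero]

/-- Verbitsky's expression in closed form: `Σ_{i≠j} (A_ii A_jj − A_ij A_ji) = (Tr_ι A)² − Tr_ι(A²)` in the
coefficient ring, with no hypothesis on `A` (`Tr_ι A = Σ_i A_ii` the partial trace, `Tr_ι(A²) = Σ_{i,j} A_ij A_ji`).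
[cite: Verbitsky1996Hyperholomorphic, §5 p.20 L59–67, p.21 L4–13] -/
theorem sum_erase_eq_trace_sq_sub_trace_mul_self (A : Matrix ι ι S) :
    ∑ i, ∑ j ∈ univ.erase i, (A i i * A j j - A i j * A j i) = (trace A) ^ 2 - trace (A * A) := by
  rw [sum_erase_eq_sum_sum, ← sum_sum_mul_swap_eq_trace_mul_self, trace_eq_sum_diag A,
    ← sum_sum_diag_mul_diag_eq_sq]
  simp only [Finset.sum_sub_distrib]

/-- "First of all, `2 Σ_{i≠j} A_ii A_jj = (Σ A_ii)² − Σ A_ii²`" — over ORDERED pairs `i ≠ j` the identity holds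
without the factor `2` (precision P-V51-2): `Σ_{i≠j} A_ii A_jj = (Σ_i A_ii)² − Σ_i A_ii²`.
[cite: Verbitsky1996Hyperholomorphic, §5 p.21 L4–13] -/
theorem sum_erase_diag_mul_diag (A : Matrix ι ι S) :
    ∑ i, ∑ j ∈ univ.erase i, A i i * A j j = (∑ i, A i i) ^ 2 - ∑ i, A i i ^ 2 := by
  have h : ∀ i, ∑ j ∈ univ.erase i, A i i * A j j = ∑ j, A i i * A j j - A i i * A i i := fun i =>
    Finset.sum_erase_eq_sub (Finset.mem_univ i)
  simp only [h, Finset.sum_sub_distrib, sq, Finset.sum_mul_sum]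

/-- "By (5.5), `Σ A_ii = 0` and therefore `2 Σ_{i≠j} A_ii A_jj = −Σ A_ii²`" (ordered pairs, no factor `2`):
under (5.5) the diagonal part of Verbitsky's expression is `−Σ_i A_ii²`.
[cite: Verbitsky1996Hyperholomorphic, §5 (5.5) p.20 L57–58, p.21 L14–21] -/
theorem sum_erase_diag_mul_diag_of_sum_diag_eq_zero (A : Matrix ι ι S) (h55 : ∑ i, A i i = 0) :
    ∑ i, ∑ j ∈ univ.erase i, A i i * A j j = -∑ i, A i i ^ 2 := by
  rw [sum_erase_diag_mul_diag, h55, sq, zero_mul, zero_sub]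

/-- The off-diagonal part of Verbitsky's expression: `Σ_{i≠j} A_ij A_ji = Tr_ι(A²) − Σ_i A_ii²`.
[cite: Verbitsky1996Hyperholomorphic, §5 p.20 L59–78 (the term "Σ_{i≠j} −A_ij A_ji")] -/
theorem sum_erase_mul_swap (A : Matrix ι ι S) :
    ∑ i, ∑ j ∈ univ.erase i, A i j * A j i = trace (A * A) - ∑ i, A i i ^ 2 := by
  have h : ∀ i, ∑ j ∈ univ.erase i, A i j * A j i = ∑ j, A i j * A j i - A i i * A i i := fun i =>
    Finset.sum_erase_eq_sub (Finset.mem_univ i)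
  simp only [h, Finset.sum_sub_distrib, sq, sum_sum_mul_swap_eq_trace_mul_self]

/-- Under (5.5) `Σ_i A_ii = 0`, Verbitsky's expression is `−Tr_ι(A²) = −Σ_{i,j} A_ij A_ji`.
[cite: Verbitsky1996Hyperholomorphic, §5 (5.5), p.20 L59–p.21 L21] -/
theorem sum_erase_eq_neg_trace_mul_self_of_sum_diag_eq_zero (A : Matrix ι ι S) (h55 : ∑ i, A i i = 0) :
    ∑ i, ∑ j ∈ univ.erase i, (A i i * A j j - A i j * A j i) = -trace (A * A) := by
  rw [sum_erase_eq_trace_sq_sub_trace_mul_self, trace_eq_sum_diag A, h55, sq, zero_mul, zero_sub]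

end Ring

/-! ### §2 The trace form on `M_r(ℂ)`: `Tr(A A^⊥) = Σ |a_kl|² ≥ 0`, `= 0` iff `A = 0` -/

section Complex

variable {m : Type*} [Fintype m]

/-- `Tr(A A^⊥) = Σ_{k,l} |A_kl|²` as a complex number ("`Tr(AA^⊥) > 0` for every non-zero matrix `A`").
[cite: Verbitsky1996Hyperholomorphic, §5 p.20 L68] -/
theorem trace_mul_conjTranspose_eq_sum_normSq (M : Matrix m m ℂ) :
    trace (M * Mᴴ) = ((∑ k, ∑ l, Complex.normSq (M k l) : ℝ) : ℂ) := by
  simp only [trace, diag_apply, mul_apply, conjTranspose_apply, Complex.star_def, Complex.mul_conj,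
    Complex.ofReal_sum]

/-- The real number `Σ_{k,l} |A_kl|²` is non-negative. [folklore] -/
private theorem sum_normSq_nonneg (M : Matrix m m ℂ) : 0 ≤ ∑ k, ∑ l, Complex.normSq (M k l) :=
  Finset.sum_nonneg fun _ _ => Finset.sum_nonneg fun _ _ => Complex.normSq_nonneg _

/-- `Σ_{k,l} |A_kl|² = 0` iff `A = 0`. [folklore] -/
private theorem sum_normSq_eq_zero_iff (M : Matrix m m ℂ) :
    ∑ k, ∑ l, Complex.normSq (M k l) = 0 ↔ M = 0 := by
  rw [Finset.sum_eq_zero_iff_of_nonneg fun _ _ => Finset.sum_nonneg fun _ _ => Complex.normSq_nonneg _]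
  simp only [Finset.mem_univ, true_implies,
    Finset.sum_eq_zero_iff_of_nonneg fun _ _ => Complex.normSq_nonneg _, Complex.normSq_eq_zero]
  exact ⟨fun h => Matrix.ext fun k l => h k l, fun h k l => by rw [h]; rfl⟩

/-- "`Tr(AA^⊥) > 0` for every non-zero matrix `A`" (as a complex number, in the order of `ℂ`: real and positive).
[cite: Verbitsky1996Hyperholomorphic, §5 p.20 L68] -/
theorem trace_mul_conjTranspose_pos {M : Matrix m m ℂ} (hM : M ≠ 0) : 0 < trace (M * Mᴴ) := by
  rw [trace_mul_conjTranspose_eq_sum_normSq, ← Complex.ofReal_zero, Complex.real_lt_real]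
  exact lt_of_le_of_ne (sum_normSq_nonneg M) fun h => hM ((sum_normSq_eq_zero_iff M).mp h.symm)

variable [DecidableEq m]

/-! ### §3 Inequality (5.1) in Verbitsky's coordinates

The coefficients `A_ij ∈ End(B_x) = M_r(ℂ)` of `Θ^{2,0} = Σ_{i,j} A_ij x_i ∧ x'_j` form a block matrix
`A : Matrix ι ι (Matrix m m ℂ)`. Hypotheses as used in print: (5.4) `A_ji = A_ij^⊥` (so each `A_ii` is Hermitian),
(5.5) `Σ_i A_ii = 0`. -/

omit [Fintype ι] [DecidableEq m] in
/-- Under (5.4), `Tr(A_ij A_ji) = Tr(A_ij A_ij^⊥)` — the step marked "(5.4)" over the equality signs of p.20 L69–78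
and p.21 L23–33. [cite: Verbitsky1996Hyperholomorphic, §5 (5.4)] -/
theorem trace_mul_swap_eq_trace_mul_conjTranspose (A : Matrix ι ι (Matrix m m ℂ))
    (h54 : ∀ i j, A j i = (A i j)ᴴ) (i j : ι) : trace (A i j * A j i) = trace (A i j * (A i j)ᴴ) := by
  rw [h54 i j]

omit [Fintype ι] [Fintype m] [DecidableEq m] in
/-- (5.4) on the diagonal: each `A_ii` is Hermitian ("`Tr Σ −A_ii² = Tr Σ −A_ii A_ii^⊥`" uses `A_ii = A_ii^⊥`).
[cite: Verbitsky1996Hyperholomorphic, §5 (5.4), p.21 L22–33] -/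
theorem diag_eq_conjTranspose (A : Matrix ι ι (Matrix m m ℂ)) (h54 : ∀ i j, A j i = (A i j)ᴴ) (i : ι) :
    A i i = (A i i)ᴴ :=
  h54 i i

variable [DecidableEq ι]

omit [DecidableEq m] in
/-- OFF-DIAGONAL PART (needs (5.4) only):
`Tr Σ_{i≠j} −A_ij A_ji = Tr Σ_{i≠j} −A_ij A_ij^⊥ = −Σ_{i≠j} Σ_{k,l} |(A_ij)_kl|²`.
[cite: Verbitsky1996Hyperholomorphic, §5 p.20 L68–78] -/
theorem trace_sum_erase_neg_mul_swap_eq (A : Matrix ι ι (Matrix m m ℂ)) (h54 : ∀ i j, A j i = (A i j)ᴴ) :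
    trace (∑ i, ∑ j ∈ univ.erase i, -(A i j * A j i)) =
      -((∑ i, ∑ j ∈ univ.erase i, ∑ k, ∑ l, Complex.normSq (A i j k l) : ℝ) : ℂ) := by
  simp only [trace_sum, trace_neg, Finset.sum_neg_distrib, Complex.ofReal_sum,
    trace_mul_swap_eq_trace_mul_conjTranspose A h54, trace_mul_conjTranspose_eq_sum_normSq]

omit [DecidableEq m] in
/-- "… `< 0` if any of `A_ij`, `i ≠ j` is non-zero": under (5.4) the off-diagonal part of
`Tr Λ_c²(Θ^{2,0} ∧ Θ^{2,0})` is `< 0` as soon as one off-diagonal block is non-zero.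
[cite: Verbitsky1996Hyperholomorphic, §5 p.20 L68–p.21 L1] -/
theorem trace_sum_erase_neg_mul_swap_neg (A : Matrix ι ι (Matrix m m ℂ)) (h54 : ∀ i j, A j i = (A i j)ᴴ)
    {i₀ j₀ : ι} (hne : i₀ ≠ j₀) (hA : A i₀ j₀ ≠ 0) :
    trace (∑ i, ∑ j ∈ univ.erase i, -(A i j * A j i)) < 0 := by
  rw [trace_sum_erase_neg_mul_swap_eq A h54, neg_lt_zero, ← Complex.ofReal_zero, Complex.real_lt_real]
  have hle : ∀ i, 0 ≤ ∑ j ∈ univ.erase i, ∑ k, ∑ l, Complex.normSq (A i j k l) := fun i =>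
    Finset.sum_nonneg fun j _ => sum_normSq_nonneg (A i j)
  refine lt_of_lt_of_le ?_ (Finset.single_le_sum (fun i _ => hle i) (Finset.mem_univ i₀))
  refine lt_of_lt_of_le ?_ (Finset.single_le_sum (fun j _ => sum_normSq_nonneg (A i₀ j))
    (Finset.mem_erase.mpr ⟨hne.symm, Finset.mem_univ j₀⟩))
  exact lt_of_le_of_ne (sum_normSq_nonneg _) fun h => hA ((sum_normSq_eq_zero_iff _).mp h.symm)

/-- DIAGONAL PART (needs `A_ii = A_ii^⊥` and (5.5)):
`Tr Σ_{i≠j} A_ii A_jj = Tr Σ_i −A_ii² = Tr Σ_i −A_ii A_ii^⊥ = −Σ_i Σ_{k,l} |(A_ii)_kl|²`.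
[cite: Verbitsky1996Hyperholomorphic, §5 p.21 L2–33] -/
theorem trace_sum_erase_diag_mul_diag_eq (A : Matrix ι ι (Matrix m m ℂ)) (hdiag : ∀ i, A i i = (A i i)ᴴ)
    (h55 : ∑ i, A i i = 0) :
    trace (∑ i, ∑ j ∈ univ.erase i, A i i * A j j) =
      -((∑ i, ∑ k, ∑ l, Complex.normSq (A i i k l) : ℝ) : ℂ) := by
  rw [sum_erase_diag_mul_diag_of_sum_diag_eq_zero A h55, trace_neg, trace_sum, Complex.ofReal_sum]
  congr 1
  refine Finset.sum_congr rfl fun i _ => ?_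
  rw [sq, ← trace_mul_conjTranspose_eq_sum_normSq, ← hdiag i]

/-- "… `Tr Σ_{i≠j} A_ii A_jj < 0`, if not all matrices `A_ii`, `i = 1…n` are zero" (given `A_ii = A_ii^⊥` and (5.5)).
[cite: Verbitsky1996Hyperholomorphic, §5 p.21 L2–4] -/
theorem trace_sum_erase_diag_mul_diag_neg (A : Matrix ι ι (Matrix m m ℂ)) (hdiag : ∀ i, A i i = (A i i)ᴴ)
    (h55 : ∑ i, A i i = 0) {i₀ : ι} (hA : A i₀ i₀ ≠ 0) :
    trace (∑ i, ∑ j ∈ univ.erase i, A i i * A j j) < 0 := by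
  rw [trace_sum_erase_diag_mul_diag_eq A hdiag h55, neg_lt_zero, ← Complex.ofReal_zero, Complex.real_lt_real]
  refine lt_of_lt_of_le ?_ (Finset.single_le_sum (fun i _ => sum_normSq_nonneg (A i i)) (Finset.mem_univ i₀))
  exact lt_of_le_of_ne (sum_normSq_nonneg _) fun h => hA ((sum_normSq_eq_zero_iff _).mp h.symm)

/-- The printed last line of the proof, as a decomposition: under (5.4)–(5.5),
`Tr Σ_{i≠j} (A_ii A_jj − A_ij A_ji) = Tr Σ_i −A_ii A_ii^⊥ + Tr Σ_{i≠j} −A_ij A_ij^⊥` ("Therefore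
`Tr(Λ_C²(Θ^{2,0} ∧ Θ^{2,0})) = Tr Σ −A_ii A_ii^⊥ + Tr Σ_{i≠j} −A_ij A^⊥_ij < 0` if `Θ^{2,0} ≠ 0`").
[cite: Verbitsky1996Hyperholomorphic, §5 p.21 L34–41] -/
theorem trace_sum_erase_eq_diag_add_offDiag (A : Matrix ι ι (Matrix m m ℂ)) (h54 : ∀ i j, A j i = (A i j)ᴴ)
    (h55 : ∑ i, A i i = 0) :
    trace (∑ i, ∑ j ∈ univ.erase i, (A i i * A j j - A i j * A j i)) =
      trace (∑ i, -(A i i * (A i i)ᴴ)) + trace (∑ i, ∑ j ∈ univ.erase i, -(A i j * (A i j)ᴴ)) := by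
  have hsplit : ∑ i, ∑ j ∈ univ.erase i, (A i i * A j j - A i j * A j i) =
      ∑ i, ∑ j ∈ univ.erase i, A i i * A j j + ∑ i, ∑ j ∈ univ.erase i, -(A i j * A j i) := by
    simp only [sub_eq_add_neg, Finset.sum_add_distrib]
  rw [hsplit, trace_add, sum_erase_diag_mul_diag_of_sum_diag_eq_zero A h55, ← Finset.sum_neg_distrib]
  congr 1
  · congr 1
    refine Finset.sum_congr rfl fun i _ => ?_
    rw [sq, ← h54 i i]
  · congr 1
    refine Finset.sum_congr rfl fun i _ => Finset.sum_congr rfl fun j _ => ?_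
    rw [h54 i j]

/-- **Inequality (5.1), closed form.** Under (5.4) `A_ji = A_ij^⊥` and (5.5) `Σ_i A_ii = 0`,
`Tr Σ_{i≠j} (A_ii A_jj − A_ij A_ji) = −Σ_{i,j} Σ_{k,l} |(A_ij)_kl|²` — minus the squared norm of the whole coefficient
family of `Θ^{2,0}`. [cite: Verbitsky1996Hyperholomorphic, §5 (5.1), proof pp.20–21] -/
theorem trace_sum_erase_eq_neg_sum_normSq (A : Matrix ι ι (Matrix m m ℂ)) (h54 : ∀ i j, A j i = (A i j)ᴴ)
    (h55 : ∑ i, A i i = 0) :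
    trace (∑ i, ∑ j ∈ univ.erase i, (A i i * A j j - A i j * A j i)) =
      -((∑ i, ∑ j, ∑ k, ∑ l, Complex.normSq (A i j k l) : ℝ) : ℂ) := by
  rw [sum_erase_eq_neg_trace_mul_self_of_sum_diag_eq_zero A h55, trace_neg,
    ← sum_sum_mul_swap_eq_trace_mul_self, trace_sum, Complex.ofReal_sum]
  simp only [trace_sum, Complex.ofReal_sum, trace_mul_swap_eq_trace_mul_conjTranspose A h54,
    trace_mul_conjTranspose_eq_sum_normSq]

/-- **(5.1), weak form:** `Tr Λ_c²(Θ^{2,0} ∧ Θ^{2,0}) ≤ 0` (a non-positive real number) under (5.4)–(5.5)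
("`Λ_c²(c₂(B)) ≤ 0`"). [cite: Verbitsky1996Hyperholomorphic, §5 (5.1), p.19 L50–51] -/
theorem trace_sum_erase_nonpos (A : Matrix ι ι (Matrix m m ℂ)) (h54 : ∀ i j, A j i = (A i j)ᴴ)
    (h55 : ∑ i, A i i = 0) :
    trace (∑ i, ∑ j ∈ univ.erase i, (A i i * A j j - A i j * A j i)) ≤ 0 := by
  rw [trace_sum_erase_eq_neg_sum_normSq A h54 h55, neg_nonpos, ← Complex.ofReal_zero, Complex.real_le_real]
  exact Finset.sum_nonneg fun i _ => Finset.sum_nonneg fun j _ => sum_normSq_nonneg (A i j)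

/-- **(5.1), equality case:** under (5.4)–(5.5), `Tr Λ_c²(Θ^{2,0} ∧ Θ^{2,0}) = 0` at a point iff `Θ^{2,0} = 0`
there, i.e. iff every coefficient `A_ij` vanishes ("`Λ_c²(c₂(B)) = 0` only if `Θ^{2,0} = 0` everywhere").
[cite: Verbitsky1996Hyperholomorphic, §5 (5.1) and p.19 L50–55] -/
theorem trace_sum_erase_eq_zero_iff (A : Matrix ι ι (Matrix m m ℂ)) (h54 : ∀ i j, A j i = (A i j)ᴴ)
    (h55 : ∑ i, A i i = 0) :
    trace (∑ i, ∑ j ∈ univ.erase i, (A i i * A j j - A i j * A j i)) = 0 ↔ A = 0 := by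
  rw [trace_sum_erase_eq_neg_sum_normSq A h54 h55, neg_eq_zero, Complex.ofReal_eq_zero,
    Finset.sum_eq_zero_iff_of_nonneg fun i _ => Finset.sum_nonneg fun j _ => sum_normSq_nonneg (A i j)]
  simp only [Finset.mem_univ, true_implies, Finset.sum_eq_zero_iff_of_nonneg fun j _ => sum_normSq_nonneg _,
    sum_normSq_eq_zero_iff]
  exact ⟨fun h => Matrix.ext fun i j => h i j, fun h i j => by rw [h]; rfl⟩

/-- **Inequality (5.1) as printed:** "`Tr(Λ_c²(Θ^{2,0} ∧ Θ^{2,0})) < 0` for point `x ∈ M` such that `Θ^{2,0} ≠ 0`"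
— under (5.4)–(5.5), if some coefficient `A_ij ≠ 0` then `Tr Σ_{i≠j} (A_ii A_jj − A_ij A_ji) < 0` (real and
negative). [cite: Verbitsky1996Hyperholomorphic, §5 (5.1) p.19 L1–7, proof pp.20–21] -/
theorem trace_sum_erase_neg (A : Matrix ι ι (Matrix m m ℂ)) (h54 : ∀ i j, A j i = (A i j)ᴴ)
    (h55 : ∑ i, A i i = 0) (hA : A ≠ 0) :
    trace (∑ i, ∑ j ∈ univ.erase i, (A i i * A j j - A i j * A j i)) < 0 :=
  lt_of_le_of_ne (trace_sum_erase_nonpos A h54 h55) fun h => hA ((trace_sum_erase_eq_zero_iff A h54 h55).mp h)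

/-- Real-part reading of (5.1): under (5.4)–(5.5) the trace is the real number `−Σ |(A_ij)_kl|²` — its real part is
that sum with a minus sign and its imaginary part vanishes. [cite: Verbitsky1996Hyperholomorphic, §5 (5.1)] -/
theorem re_trace_sum_erase_eq (A : Matrix ι ι (Matrix m m ℂ)) (h54 : ∀ i j, A j i = (A i j)ᴴ)
    (h55 : ∑ i, A i i = 0) :
    (trace (∑ i, ∑ j ∈ univ.erase i, (A i i * A j j - A i j * A j i))).re =
        -∑ i, ∑ j, ∑ k, ∑ l, Complex.normSq (A i j k l) ∧
      (trace (∑ i, ∑ j ∈ univ.erase i, (A i i * A j j - A i j * A j i))).im = 0 := by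
  rw [trace_sum_erase_eq_neg_sum_normSq A h54 h55]
  simp only [Complex.neg_re, Complex.ofReal_re, Complex.neg_im, Complex.ofReal_im, neg_zero, and_self]

/-- Real-part reading of (5.1), strict: under (5.4)–(5.5) and `Θ^{2,0} ≠ 0` (some `A_ij ≠ 0`) the real part of
`Tr Σ_{i≠j} (A_ii A_jj − A_ij A_ji)` is `< 0`. [cite: Verbitsky1996Hyperholomorphic, §5 (5.1) p.19 L1–7] -/
theorem re_trace_sum_erase_neg (A : Matrix ι ι (Matrix m m ℂ)) (h54 : ∀ i j, A j i = (A i j)ᴴ)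
    (h55 : ∑ i, A i i = 0) (hA : A ≠ 0) :
    (trace (∑ i, ∑ j ∈ univ.erase i, (A i i * A j j - A i j * A j i))).re < 0 :=
  (Complex.neg_iff.mp (trace_sum_erase_neg A h54 h55 hA)).1

/-! ### §4 The same inequality read on the block matrix `(A_ij) ∈ M_{n·r}(ℂ)`

`Matrix.comp` identifies the block family `A` with one `(ι × m) × (ι × m)` complex matrix `Â`; (5.4) says `Â` is
Hermitian, (5.5) says its partial trace over `ι` vanishes, and Verbitsky's trace is `Tr_m((Tr_ι A)²) − Tr(Â²)`,
which under (5.4)–(5.5) is `−Tr(Â Â^⊥) ≤ 0`, `= 0` iff `Â = 0`. -/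

omit [Fintype ι] [Fintype m] [DecidableEq ι] [DecidableEq m] in
/-- The conjugate transpose of the block matrix is the block matrix of the transposed family of conjugate
transposes. [folklore] -/
private theorem conjTranspose_comp (A : Matrix ι ι (Matrix m m ℂ)) :
    (comp ι ι m m ℂ A)ᴴ = comp ι ι m m ℂ (fun i j => (A j i)ᴴ) := by
  ext ⟨i, k⟩ ⟨j, l⟩
  rfl

omit [Fintype ι] [Fintype m] [DecidableEq ι] [DecidableEq m] in
/-- (5.4) `A_ji = A_ij^⊥` for all `i, j` iff the block matrix `Â = (A_ij)` is Hermitian (precision P-V51-1: this is the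
form in which (5.4) is used). [cite: Verbitsky1996Hyperholomorphic, §5 (5.4) p.20 L28–35] -/
theorem isHermitian_comp_iff (A : Matrix ι ι (Matrix m m ℂ)) :
    (comp ι ι m m ℂ A).IsHermitian ↔ ∀ i j, A j i = (A i j)ᴴ := by
  rw [IsHermitian, conjTranspose_comp, (comp ι ι m m ℂ).apply_eq_iff_eq]
  constructor
  · intro h i j
    have := congr_fun (congr_fun h j) i
    exact this.symm
  · intro h
    funext i j
    exact (h j i).symm

omit [DecidableEq ι] [DecidableEq m] in
/-- The block matrix of a product is the product of the block matrices (`Matrix.compRingEquiv`). [folklore] -/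
private theorem comp_mul (A B : Matrix ι ι (Matrix m m ℂ)) :
    comp ι ι m m ℂ (A * B) = comp ι ι m m ℂ A * comp ι ι m m ℂ B := by
  rw [← compRingEquiv_apply, map_mul, compRingEquiv_apply, compRingEquiv_apply]

omit [DecidableEq ι] [DecidableEq m] in
/-- The total trace of the block matrix is the trace of the partial trace: `Tr(Â) = Tr_m(Tr_ι A)`. [folklore] -/
private theorem trace_comp (A : Matrix ι ι (Matrix m m ℂ)) : trace (comp ι ι m m ℂ A) = trace (trace A) := by
  simp only [trace, diag_apply, comp_apply, Fintype.sum_prod_type, Matrix.sum_apply]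
  exact Finset.sum_comm

/-- Verbitsky's trace on the block matrix, with no hypothesis on `A`:
`Tr Σ_{i≠j} (A_ii A_jj − A_ij A_ji) = Tr_m((Σ_i A_ii)²) − Tr(Â²)`. [cite: Verbitsky1996Hyperholomorphic, §5 p.20 L59–67] -/
theorem trace_sum_erase_eq_trace_sq_sub_trace_comp_sq (A : Matrix ι ι (Matrix m m ℂ)) :
    trace (∑ i, ∑ j ∈ univ.erase i, (A i i * A j j - A i j * A j i)) =
      trace ((∑ i, A i i) ^ 2) - trace ((comp ι ι m m ℂ A) ^ 2) := by
  rw [sum_erase_eq_trace_sq_sub_trace_mul_self, trace_sub, trace_eq_sum_diag A, sq (comp ι ι m m ℂ A),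
    ← comp_mul, trace_comp]

/-- Under (5.4)–(5.5), on the block matrix: `Tr Σ_{i≠j} (A_ii A_jj − A_ij A_ji) = −Tr(Â Â^⊥)`.
[cite: Verbitsky1996Hyperholomorphic, §5 (5.1), proof pp.20–21] -/
theorem trace_sum_erase_eq_neg_trace_comp_mul_conjTranspose (A : Matrix ι ι (Matrix m m ℂ))
    (h54 : ∀ i j, A j i = (A i j)ᴴ) (h55 : ∑ i, A i i = 0) :
    trace (∑ i, ∑ j ∈ univ.erase i, (A i i * A j j - A i j * A j i)) =
      -trace (comp ι ι m m ℂ A * (comp ι ι m m ℂ A)ᴴ) := by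
  rw [trace_sum_erase_eq_trace_sq_sub_trace_comp_sq, h55, sq, zero_mul, trace_zero, zero_sub,
    ((isHermitian_comp_iff A).mpr h54).eq, sq]

/-- (5.1) on the block matrix, equality case (via Mathlib's `Tr(Â Â^⊥) = 0 ↔ Â = 0`): under (5.4)–(5.5) the trace
vanishes iff the block matrix `Â` — equivalently `Θ^{2,0}` — vanishes.
[cite: Verbitsky1996Hyperholomorphic, §5 (5.1) and p.19 L50–55] -/
theorem trace_sum_erase_eq_zero_iff_comp_eq_zero (A : Matrix ι ι (Matrix m m ℂ))
    (h54 : ∀ i j, A j i = (A i j)ᴴ) (h55 : ∑ i, A i i = 0) :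
    trace (∑ i, ∑ j ∈ univ.erase i, (A i i * A j j - A i j * A j i)) = 0 ↔ comp ι ι m m ℂ A = 0 := by
  rw [trace_sum_erase_eq_neg_trace_comp_mul_conjTranspose A h54 h55, neg_eq_zero,
    trace_mul_conjTranspose_self_eq_zero_iff]

/-! ### §5 The opposite sign convention (precision P-V51-3)

With the real structure `A ↦ A^⊥` instead of `A ↦ −A^⊥` ("For a real structure `T`, the operator `−T` also defines
a real structure", §3 p.11 L22–23), or with `J̄(x'_i) = x_i` instead of `−x_i`, (5.4) becomes `A_ji = −A_ij^⊥` and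
the sign of (5.1) flips; the DEFINITENESS — the only thing the proof of Theorem 2.5 uses — does not. -/

/-- Sign-flipped twin of (5.1): if `A_ji = −A_ij^⊥` (the other printed real structure) and `Σ_i A_ii = 0` then
`Tr Σ_{i≠j} (A_ii A_jj − A_ij A_ji) = +Σ_{i,j} Σ_{k,l} |(A_ij)_kl|²`.
[cite: Verbitsky1996Hyperholomorphic, §5 (5.1) with §3 p.11 L22–23 (real structures ±T)] -/
theorem trace_sum_erase_eq_sum_normSq_of_skew (A : Matrix ι ι (Matrix m m ℂ)) (h54' : ∀ i j, A j i = -(A i j)ᴴ)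
    (h55 : ∑ i, A i i = 0) :
    trace (∑ i, ∑ j ∈ univ.erase i, (A i i * A j j - A i j * A j i)) =
      ((∑ i, ∑ j, ∑ k, ∑ l, Complex.normSq (A i j k l) : ℝ) : ℂ) := by
  rw [sum_erase_eq_neg_trace_mul_self_of_sum_diag_eq_zero A h55, trace_neg,
    ← sum_sum_mul_swap_eq_trace_mul_self, trace_sum, Complex.ofReal_sum, ← Finset.sum_neg_distrib]
  refine Finset.sum_congr rfl fun i _ => ?_
  rw [trace_sum, Complex.ofReal_sum, ← Finset.sum_neg_distrib]
  refine Finset.sum_congr rfl fun j _ => ?_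
  rw [h54' i j, mul_neg, trace_neg, neg_neg, trace_mul_conjTranspose_eq_sum_normSq]

/-- Sign-flipped twin of (5.1), equality case: under `A_ji = −A_ij^⊥` and `Σ_i A_ii = 0` the trace (now `≥ 0`)
vanishes iff `A = 0` — definiteness survives the sign convention.
[cite: Verbitsky1996Hyperholomorphic, §5 (5.1), p.19 L50–55, with §3 p.11 L22–23] -/
theorem trace_sum_erase_eq_zero_iff_of_skew (A : Matrix ι ι (Matrix m m ℂ)) (h54' : ∀ i j, A j i = -(A i j)ᴴ)
    (h55 : ∑ i, A i i = 0) :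
    trace (∑ i, ∑ j ∈ univ.erase i, (A i i * A j j - A i j * A j i)) = 0 ↔ A = 0 := by
  rw [trace_sum_erase_eq_sum_normSq_of_skew A h54' h55, Complex.ofReal_eq_zero,
    Finset.sum_eq_zero_iff_of_nonneg fun i _ => Finset.sum_nonneg fun j _ => sum_normSq_nonneg (A i j)]
  simp only [Finset.mem_univ, true_implies, Finset.sum_eq_zero_iff_of_nonneg fun j _ => sum_normSq_nonneg _,
    sum_normSq_eq_zero_iff]
  exact ⟨fun h => Matrix.ext fun i j => h i j, fun h i j => by rw [h]; rfl⟩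

end Complex

end Literature.Geometry.Hyperkaehler.TwoZeroCurvature
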